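import Summits.QuantumFields.YangMills.Theorems.FluctuationComparisonRegPrIntLS2BetaTransversalShiftUniform
import Summits.QuantumFields.YangMills.Theorems.FluctuationComparisonRegPrIntLS2BetaFibreTransportCharted
import HarnessLib

/-!
# S2β · DET-REP-B‴ — THE CORNER OF RECORD: BY-TEXT suppliers for the BASE-corner rows of LINE g18-1's displayed organ `DetRepB`

Definition-free helper for `Cruxes/FluctuationComparisonRegPrIntL/Lines/semiclassical_s2beta.lean` v11.2a∕v11.3 (crux `stmt-QuantumFields-20520`; width seat
`ym-ust-20520-w4` g17; `--supports`, NOT a proof of any stub).  `DetRepB` asserts, per window quadrilateral, `∃ (tube) I (edges x₀ y₀ x₁ y₁), TubeRows ∧ IsOpen I ∧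
Icc 0 1 ⊆ I ∧ EdgeRows … b U V x₀ y₀ ∧ EdgeRows … b W Z x₁ y₁ ∧ ⟨value rows⟩`.  OBSERVATION OF RECORD (w4 g17, 2026-08-30 02:23Z): the B‴ door
`fourPtDecay_of_detRep` reads ✓`edge_rep_det`'s (REP) row only at `s ∈ {0,1}` and discards (DET); `edge_rep_det` is pointwise in `s` and needs only `IsOpen I`.
So the organ's PATH content lives in the single clause `Icc 0 1 ⊆ I`; every other `EdgeRows` clause is a per-value CORNER reading plus local regularity of
`x, y` at `s`.  THIS FILE supplies, by text (token-identical to the line's `def EdgeRows` body, which a Theorems file cannot import):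

* ★ `exists_tubeRows_pos` — ✓`…S2BetaTubeOfRecord.exists_tubeRows` (p755703) with the two rows of px21 g11's E3″ it dropped: `0 < jV 0` and `∀ᶠ y in 𝓝 0, 0 < jV y`;
* ★★ `edgeRows_text_of_locallyConst` — for data `x, y` LOCALLY CONSTANT at every `s ∈ I`, the `EdgeRows` text follows from per-value corner rows (continuity and
  `C^∞`-smoothness by local constancy, the JOINT carrier row from the fibrewise one);
* ★★ `cornerRows_base_text` — at the BASE corner `X` with `U₀ ∈ argminHist X` (unfolded) and the tube of record through `U₀` (`σ 0 = U₀`, `0 ∈ UV`, `0 < jV 0`),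
  the corner rows hold at `y = 0` by the two recognition clauses of the line's `ChartRows` (self-charting of live fibre points, carrier neighbourhood);
* ★ `edgeRows_text_const` — corollary: the `EdgeRows` text for the constant edge `A = B = X`, `x ≡ X`, `y ≡ 0` on any `I`.

HONEST: bookkeeping over landed letters; the three NON-base corners («the minimisers over `V, W, Z` are read in `U₀`'s tube») and the VALUE rows DETN∕JACW are the organ
and are NOT touched; proves NO stub — EXW, GAP♯, DET-REP-B‴, H4ᶜ, LFR♯ᶜ, S2β and crux 20520 stay OPEN; rung R3 (YM₃ on T³) is NOT d = 4, NOT infinite volume, NOT a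
mass gap, NOT Clay; the Yang–Mills mass gap is NOT proved.

References: [Helgason2000] Ch. I §1 Thm 1.14 p. 96; [Balaban1985Variational] CMP 102 (1985) Thm 1 (8)–(10) p. 279, (142) p. 299; [Balaban1985Averaging] CMP 98 (1985)
(8), (10) p. 18; [Balaban1987RG1] CMP 109 (1987) (0.13) p. 254.
-/

noncomputable section

open MeasureTheory MeasureTheory.Measure Filter Topology Set Function Metric
open scoped ENNReal Matrix.Norms.L2Operator ContDiff
open Literature.MathematicalPhysics.QuantumFieldTheory.Balaban1983to89
open Literature.MathematicalPhysics.QuantumFieldTheory.Balaban1983to89.T3ContinuumYM3Torus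
open Literature.MathematicalPhysics.QuantumFieldTheory.Balaban1983to89.HaarExponentialChart
open Literature.MathematicalPhysics.QuantumFieldTheory.Balaban1983to89.LogChartProduct
open Literature.MathematicalPhysics.QuantumFieldTheory.Balaban1983to89.T3UnitLawDensityEML
open Literature.MathematicalPhysics.QuantumFieldTheory.Balaban1983to89.T3TiltDescent
open Literature.MathematicalPhysics.QuantumFieldTheory.Balaban1983to89.T3ConstrainedMinimiser (fibre)
open Literature.MathematicalPhysics.QuantumFieldTheory.Balaban1983to89.T4Continuum
open scoped Literature.MathematicalPhysics.QuantumFieldTheory.Balaban1983to89.T3OrbitAverage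
open Summit.QuantumFields.YangMills.Theorems.FluctuationComparisonRegPrIntLWregChain (iterCentralBond)
open Summit.QuantumFields.YangMills.Theorems.FluctuationComparisonRegPrIntLWregGlue (WindowChart)
open Summit.QuantumFields.YangMills.Theorems.FluctuationComparisonRegPrIntLS2BetaResidualSubgroup
open Summit.QuantumFields.YangMills.Theorems.FluctuationComparisonRegPrIntLS2BetaTubularChartDockLocal
open Summit.QuantumFields.YangMills.Theorems.FluctuationComparisonRegPrIntLS2BetaTransversalShiftUniform
open Summit.QuantumFields.YangMills.Theorems.FluctuationComparisonRegPrIntLS2BetaSignedCombKill (combSet)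

namespace Summit.QuantumFields.YangMills.Theorems.FluctuationComparisonRegPrIntLS2BetaCornerOfRecord

variable (F : T3Family) {J K : ℕ} (hJK : J ≤ K)

/-! ## §1 The tube of record, with the positivity rows of its transversal density -/

/-- ★ **THE TUBE OF RECORD, WITH `0 < jV 0` AND EVENTUAL POSITIVITY OF `jV`** — ✓`…S2BetaTubeOfRecord.exists_tubeRows` verbatim (px21 g11's E3″ chart with the
transversal window shrunk to `‖(eV y)_b‖ < 1∕2`, (T2-ALL) by ✓`offPivot_transversal_shift_uniform`, the Haar chart identity restricted to the smaller window) PLUS the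
two rows `0 < jV 0`, `∀ᶠ y in 𝓝 0, 0 < jV y` of E3″ that the base corner's `EdgeRows` clause `0 < jV (y s)` reads.
[cite: Helgason2000, Ch. I §1 Thm 1.14 p.96; Balaban1985Variational, Thm 1 (8)-(10) p.279 and (142) p.299; Balaban1985Averaging, (8), (10) p.18] -/
theorem exists_tubeRows_pos (hk : K - J ≤ (F.P K).m + (F.P K).K)
    [DecidablePred (· ∈ (combSet (K - J) : Set (PBond (F.P K) 0)) ∪ Set.range (iterCentralBond (P := F.P K) (K - J)))] (dZ dV : ℕ)
    (hdZ : dZ = Module.finrank ℝ (specialUnitaryLogChart (Fin 2)).lie *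
      ((Fintype.card (Site (F.P K) 0) - Fintype.card (Site (F.P K) (K - J))) + Fintype.card (PBond (F.P K) (K - J))))
    (hdV : dV = Module.finrank ℝ (specialUnitaryLogChart (Fin 2)).lie *
        (Fintype.card (PBond (F.P K) 0) - Fintype.card (PBond (F.P K) (K - J))) -
      Module.finrank ℝ (specialUnitaryLogChart (Fin 2)).lie * (Fintype.card (Site (F.P K) 0) - Fintype.card (Site (F.P K) (K - J))))
    (U₀ : GaugeField (F.P K) 0 (Matrix.specialUnitaryGroup (Fin 2) ℂ)) :
    ∃ (e : EuclideanSpace ℝ (Fin dZ) → ↥(residualSubgroup F hJK) × (PBond (F.P K) (K - J) → Matrix.specialUnitaryGroup (Fin 2) ℂ))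
      (σ : EuclideanSpace ℝ (Fin dV) → GaugeField (F.P K) 0 (Matrix.specialUnitaryGroup (Fin 2) ℂ))
      (UZ : Set (EuclideanSpace ℝ (Fin dZ))) (UV : Set (EuclideanSpace ℝ (Fin dV)))
      (jZ : EuclideanSpace ℝ (Fin dZ) → ℝ) (jV : EuclideanSpace ℝ (Fin dV) → ℝ) (ρ : ℝ),
      σ 0 = U₀ ∧ (0 : EuclideanSpace ℝ (Fin dV)) ∈ UV ∧ 0 < jV 0 ∧ (∀ᶠ y in 𝓝 (0 : EuclideanSpace ℝ (Fin dV)), 0 < jV y) ∧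
      (Continuous e ∧ e 0 = 1 ∧
      𝓝 (1 : ↥(residualSubgroup F hJK) × (PBond (F.P K) (K - J) → Matrix.specialUnitaryGroup (Fin 2) ℂ)) ≤ map e (𝓝 0) ∧
      Continuous σ ∧
      ContDiff ℝ ⊤ (fun y : EuclideanSpace ℝ (Fin dV) => fun b : PBond (F.P K) 0 => ((σ y b : Matrix.specialUnitaryGroup (Fin 2) ℂ) : Matrix (Fin 2) (Fin 2) ℂ)) ∧
      IsOpen UZ ∧ IsOpen UV ∧ (0 : EuclideanSpace ℝ (Fin dZ)) ∈ UZ ∧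
      (∀ y₁ ∈ UV, ∃ c : ℝ, 0 < c ∧ ∀ᶠ v in 𝓝 (0 : EuclideanSpace ℝ (Fin dV)),
        c * ‖v‖ ^ 2 ≤ ⨅ w : {w : Site (F.P K) 0 → Matrix.specialUnitaryGroup (Fin 2) ℂ |
              ∀ U : GaugeField (F.P K) 0 (Matrix.specialUnitaryGroup (Fin 2) ℂ),
                descendTo F ℰp J K hJK (GaugeField.gaugeAct w U) = descendTo F ℰp J K hJK U},
            ∑ ℓ ∈ Finset.univ.filter (fun ℓ : PBond (F.P K) 0 =>
                ∀ c', iterCentralBond (P := F.P K) (K - J) c' ≠ ℓ),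
              dist1 (σ (y₁ + v) ℓ * ((GaugeField.gaugeAct (w : Site (F.P K) 0 → Matrix.specialUnitaryGroup (Fin 2) ℂ) (σ y₁)) ℓ)⁻¹) ^ 2) ∧
      InjOn (fun p : EuclideanSpace ℝ (Fin dZ) × EuclideanSpace ℝ (Fin dV) =>
        pivotAct F hJK (iterCentralBond (P := F.P K) (K - J)) (e p.1) (σ p.2)) (UZ ×ˢ UV) ∧
      (∀ p ∈ UZ ×ˢ UV, ∀ s ∈ 𝓝 p, (fun p : EuclideanSpace ℝ (Fin dZ) × EuclideanSpace ℝ (Fin dV) =>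
        pivotAct F hJK (iterCentralBond (P := F.P K) (K - J)) (e p.1) (σ p.2)) '' s ∈
        𝓝 ((fun p : EuclideanSpace ℝ (Fin dZ) × EuclideanSpace ℝ (Fin dV) =>
        pivotAct F hJK (iterCentralBond (P := F.P K) (K - J)) (e p.1) (σ p.2)) p)) ∧
      ContinuousOn jZ UZ ∧ ContinuousOn jV UV ∧ (∀ z ∈ UZ, 0 ≤ jZ z) ∧ (∀ y ∈ UV, 0 ≤ jV y) ∧
      (fieldMeasure (F.P K) 0 (Matrix.specialUnitaryGroup (Fin 2) ℂ)).restrict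
          ((fun p : EuclideanSpace ℝ (Fin dZ) × EuclideanSpace ℝ (Fin dV) =>
            pivotAct F hJK (iterCentralBond (P := F.P K) (K - J)) (e p.1) (σ p.2)) '' (UZ ×ˢ UV)) =
        ((((volume : Measure (EuclideanSpace ℝ (Fin dZ))).prod (volume : Measure (EuclideanSpace ℝ (Fin dV)))).restrict (UZ ×ˢ UV)).withDensity
            fun w => ENNReal.ofReal (jZ w.1 * jV w.2)).map
          (fun p : EuclideanSpace ℝ (Fin dZ) × EuclideanSpace ℝ (Fin dV) =>
            pivotAct F hJK (iterCentralBond (P := F.P K) (K - J)) (e p.1) (σ p.2)) ∧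
      0 < ρ ∧ Metric.closedBall (0 : EuclideanSpace ℝ (Fin dZ)) ρ ⊆ UZ ∧ 0 < ∫ z in Metric.ball (0 : EuclideanSpace ℝ (Fin dZ)) ρ, jZ z) := by
  obtain ⟨e, σ, eV, UZ, UV, jZ, jV, ρ, he, he1, he𝓝, hσ, hσ0, hσs, hD0, hD1, hF4a, -, -, hUZo, hUVo, h0Z, h0V, hinj, hF3,
      hjZc, hjVc, hjZ0, hjV0, -, hjVpos, hjVev, -, hchart, hρ, hρUZ, hjZint⟩ :=
    exists_tubularHaarChart_pivotAct_local F hJK hk dZ dV hdZ hdV U₀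
  -- the uniform off-pivot transversality of the tube on the small window
  obtain ⟨c₁, hc₁, hT2u⟩ := offPivot_transversal_shift_uniform F hJK hk eV hD0 hD1 hF4a
  -- the shrunk transversal window `UV ∩ S`, `S := ‖(eV y)_b‖ < 1/2` for every free bond
  have hSo : IsOpen {y : EuclideanSpace ℝ (Fin dV) | ∀ b : {b : PBond (F.P K) 0 // b ∉ (combSet (K - J) : Set (PBond (F.P K) 0)) ∪ Set.range (iterCentralBond (P := F.P K) (K - J))}, ‖((eV y : (piLogChart (specialUnitaryLogChart (Fin 2)) {b : PBond (F.P K) 0 // b ∉ (combSet (K - J) : Set (PBond (F.P K) 0)) ∪ Set.range (iterCentralBond (P := F.P K) (K - J))}).lie) : {b : PBond (F.P K) 0 // b ∉ (combSet (K - J) : Set (PBond (F.P K) 0)) ∪ Set.range (iterCentralBond (P := F.P K) (K - J))} → Matrix (Fin 2) (Fin 2) ℂ) b‖ < 1 / 2} := by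
    rw [Set.setOf_forall]
    refine isOpen_iInter_of_finite fun b => ?_
    have hcont : Continuous fun y : EuclideanSpace ℝ (Fin dV) =>
        ‖((eV y : (piLogChart (specialUnitaryLogChart (Fin 2)) {b : PBond (F.P K) 0 // b ∉ (combSet (K - J) : Set (PBond (F.P K) 0)) ∪ Set.range (iterCentralBond (P := F.P K) (K - J))}).lie) : {b : PBond (F.P K) 0 // b ∉ (combSet (K - J) : Set (PBond (F.P K) 0)) ∪ Set.range (iterCentralBond (P := F.P K) (K - J))} → Matrix (Fin 2) (Fin 2) ℂ) b‖ :=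
      ((continuous_apply b).comp (continuous_subtype_val.comp eV.continuous)).norm
    exact isOpen_lt hcont continuous_const
  have h0S : (0 : EuclideanSpace ℝ (Fin dV)) ∈ {y : EuclideanSpace ℝ (Fin dV) | ∀ b : {b : PBond (F.P K) 0 // b ∉ (combSet (K - J) : Set (PBond (F.P K) 0)) ∪ Set.range (iterCentralBond (P := F.P K) (K - J))}, ‖((eV y : (piLogChart (specialUnitaryLogChart (Fin 2)) {b : PBond (F.P K) 0 // b ∉ (combSet (K - J) : Set (PBond (F.P K) 0)) ∪ Set.range (iterCentralBond (P := F.P K) (K - J))}).lie) : {b : PBond (F.P K) 0 // b ∉ (combSet (K - J) : Set (PBond (F.P K) 0)) ∪ Set.range (iterCentralBond (P := F.P K) (K - J))} → Matrix (Fin 2) (Fin 2) ℂ) b‖ < 1 / 2} := by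
    intro b
    simp only [map_zero, ZeroMemClass.coe_zero, Pi.zero_apply, norm_zero]
    norm_num
  have hUV'o : IsOpen (UV ∩ {y : EuclideanSpace ℝ (Fin dV) | ∀ b : {b : PBond (F.P K) 0 // b ∉ (combSet (K - J) : Set (PBond (F.P K) 0)) ∪ Set.range (iterCentralBond (P := F.P K) (K - J))}, ‖((eV y : (piLogChart (specialUnitaryLogChart (Fin 2)) {b : PBond (F.P K) 0 // b ∉ (combSet (K - J) : Set (PBond (F.P K) 0)) ∪ Set.range (iterCentralBond (P := F.P K) (K - J))}).lie) : {b : PBond (F.P K) 0 // b ∉ (combSet (K - J) : Set (PBond (F.P K) 0)) ∪ Set.range (iterCentralBond (P := F.P K) (K - J))} → Matrix (Fin 2) (Fin 2) ℂ) b‖ < 1 / 2}) := hUVo.inter hSo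
  have hsub : UZ ×ˢ (UV ∩ {y : EuclideanSpace ℝ (Fin dV) | ∀ b : {b : PBond (F.P K) 0 // b ∉ (combSet (K - J) : Set (PBond (F.P K) 0)) ∪ Set.range (iterCentralBond (P := F.P K) (K - J))}, ‖((eV y : (piLogChart (specialUnitaryLogChart (Fin 2)) {b : PBond (F.P K) 0 // b ∉ (combSet (K - J) : Set (PBond (F.P K) 0)) ∪ Set.range (iterCentralBond (P := F.P K) (K - J))}).lie) : {b : PBond (F.P K) 0 // b ∉ (combSet (K - J) : Set (PBond (F.P K) 0)) ∪ Set.range (iterCentralBond (P := F.P K) (K - J))} → Matrix (Fin 2) (Fin 2) ℂ) b‖ < 1 / 2}) ⊆ UZ ×ˢ UV := prod_mono le_rfl inter_subset_left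
  -- the tube map is continuous, hence measurable
  have hΘc : Continuous (fun p : EuclideanSpace ℝ (Fin dZ) × EuclideanSpace ℝ (Fin dV) => pivotAct F hJK (iterCentralBond (P := F.P K) (K - J)) (e p.1) (σ p.2)) :=
    (continuous_pivotAct F hJK (iterCentralBond (P := F.P K) (K - J))).comp₂ (he.comp continuous_fst) (hσ.comp continuous_snd)
  have hΘm : Measurable (fun p : EuclideanSpace ℝ (Fin dZ) × EuclideanSpace ℝ (Fin dV) => pivotAct F hJK (iterCentralBond (P := F.P K) (K - J)) (e p.1) (σ p.2)) := hΘc.measurable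
  -- the image of the smaller window is open ((F3)), hence measurable
  have hAopen : IsOpen ((fun p : EuclideanSpace ℝ (Fin dZ) × EuclideanSpace ℝ (Fin dV) => pivotAct F hJK (iterCentralBond (P := F.P K) (K - J)) (e p.1) (σ p.2)) '' (UZ ×ˢ (UV ∩ {y : EuclideanSpace ℝ (Fin dV) | ∀ b : {b : PBond (F.P K) 0 // b ∉ (combSet (K - J) : Set (PBond (F.P K) 0)) ∪ Set.range (iterCentralBond (P := F.P K) (K - J))}, ‖((eV y : (piLogChart (specialUnitaryLogChart (Fin 2)) {b : PBond (F.P K) 0 // b ∉ (combSet (K - J) : Set (PBond (F.P K) 0)) ∪ Set.range (iterCentralBond (P := F.P K) (K - J))}).lie) : {b : PBond (F.P K) 0 // b ∉ (combSet (K - J) : Set (PBond (F.P K) 0)) ∪ Set.range (iterCentralBond (P := F.P K) (K - J))} → Matrix (Fin 2) (Fin 2) ℂ) b‖ < 1 / 2}))) := by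
    refine isOpen_iff_mem_nhds.2 ?_
    rintro _ ⟨p, hp, rfl⟩
    exact hF3 p (hsub hp) _ ((hUZo.prod hUV'o).mem_nhds hp)
  have hA : MeasurableSet ((fun p : EuclideanSpace ℝ (Fin dZ) × EuclideanSpace ℝ (Fin dV) => pivotAct F hJK (iterCentralBond (P := F.P K) (K - J)) (e p.1) (σ p.2)) '' (UZ ×ˢ (UV ∩ {y : EuclideanSpace ℝ (Fin dV) | ∀ b : {b : PBond (F.P K) 0 // b ∉ (combSet (K - J) : Set (PBond (F.P K) 0)) ∪ Set.range (iterCentralBond (P := F.P K) (K - J))}, ‖((eV y : (piLogChart (specialUnitaryLogChart (Fin 2)) {b : PBond (F.P K) 0 // b ∉ (combSet (K - J) : Set (PBond (F.P K) 0)) ∪ Set.range (iterCentralBond (P := F.P K) (K - J))}).lie) : {b : PBond (F.P K) 0 // b ∉ (combSet (K - J) : Set (PBond (F.P K) 0)) ∪ Set.range (iterCentralBond (P := F.P K) (K - J))} → Matrix (Fin 2) (Fin 2) ℂ) b‖ < 1 / 2}))) := hAopen.measurableSet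
  -- the Haar chart identity restricted to the smaller window
  have hchart' : (fieldMeasure (F.P K) 0 (Matrix.specialUnitaryGroup (Fin 2) ℂ)).restrict ((fun p : EuclideanSpace ℝ (Fin dZ) × EuclideanSpace ℝ (Fin dV) => pivotAct F hJK (iterCentralBond (P := F.P K) (K - J)) (e p.1) (σ p.2)) '' (UZ ×ˢ (UV ∩ {y : EuclideanSpace ℝ (Fin dV) | ∀ b : {b : PBond (F.P K) 0 // b ∉ (combSet (K - J) : Set (PBond (F.P K) 0)) ∪ Set.range (iterCentralBond (P := F.P K) (K - J))}, ‖((eV y : (piLogChart (specialUnitaryLogChart (Fin 2)) {b : PBond (F.P K) 0 // b ∉ (combSet (K - J) : Set (PBond (F.P K) 0)) ∪ Set.range (iterCentralBond (P := F.P K) (K - J))}).lie) : {b : PBond (F.P K) 0 // b ∉ (combSet (K - J) : Set (PBond (F.P K) 0)) ∪ Set.range (iterCentralBond (P := F.P K) (K - J))} → Matrix (Fin 2) (Fin 2) ℂ) b‖ < 1 / 2}))) =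
      ((((volume : Measure (EuclideanSpace ℝ (Fin dZ))).prod (volume : Measure (EuclideanSpace ℝ (Fin dV)))).restrict (UZ ×ˢ (UV ∩ {y : EuclideanSpace ℝ (Fin dV) | ∀ b : {b : PBond (F.P K) 0 // b ∉ (combSet (K - J) : Set (PBond (F.P K) 0)) ∪ Set.range (iterCentralBond (P := F.P K) (K - J))}, ‖((eV y : (piLogChart (specialUnitaryLogChart (Fin 2)) {b : PBond (F.P K) 0 // b ∉ (combSet (K - J) : Set (PBond (F.P K) 0)) ∪ Set.range (iterCentralBond (P := F.P K) (K - J))}).lie) : {b : PBond (F.P K) 0 // b ∉ (combSet (K - J) : Set (PBond (F.P K) 0)) ∪ Set.range (iterCentralBond (P := F.P K) (K - J))} → Matrix (Fin 2) (Fin 2) ℂ) b‖ < 1 / 2}))).withDensity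
          fun w => ENNReal.ofReal (jZ w.1 * jV w.2)).map (fun p : EuclideanSpace ℝ (Fin dZ) × EuclideanSpace ℝ (Fin dV) => pivotAct F hJK (iterCentralBond (P := F.P K) (K - J)) (e p.1) (σ p.2)) := by
    have h1 : (fieldMeasure (F.P K) 0 (Matrix.specialUnitaryGroup (Fin 2) ℂ)).restrict ((fun p : EuclideanSpace ℝ (Fin dZ) × EuclideanSpace ℝ (Fin dV) => pivotAct F hJK (iterCentralBond (P := F.P K) (K - J)) (e p.1) (σ p.2)) '' (UZ ×ˢ (UV ∩ {y : EuclideanSpace ℝ (Fin dV) | ∀ b : {b : PBond (F.P K) 0 // b ∉ (combSet (K - J) : Set (PBond (F.P K) 0)) ∪ Set.range (iterCentralBond (P := F.P K) (K - J))}, ‖((eV y : (piLogChart (specialUnitaryLogChart (Fin 2)) {b : PBond (F.P K) 0 // b ∉ (combSet (K - J) : Set (PBond (F.P K) 0)) ∪ Set.range (iterCentralBond (P := F.P K) (K - J))}).lie) : {b : PBond (F.P K) 0 // b ∉ (combSet (K - J) : Set (PBond (F.P K) 0)) ∪ Set.range (iterCentralBond (P := F.P K) (K - J))} → Matrix (Fin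 2) (Fin 2) ℂ) b‖ < 1 / 2}))) =
        ((fieldMeasure (F.P K) 0 (Matrix.specialUnitaryGroup (Fin 2) ℂ)).restrict ((fun p : EuclideanSpace ℝ (Fin dZ) × EuclideanSpace ℝ (Fin dV) => pivotAct F hJK (iterCentralBond (P := F.P K) (K - J)) (e p.1) (σ p.2)) '' (UZ ×ˢ UV))).restrict ((fun p : EuclideanSpace ℝ (Fin dZ) × EuclideanSpace ℝ (Fin dV) => pivotAct F hJK (iterCentralBond (P := F.P K) (K - J)) (e p.1) (σ p.2)) '' (UZ ×ˢ (UV ∩ {y : EuclideanSpace ℝ (Fin dV) | ∀ b : {b : PBond (F.P K) 0 // b ∉ (combSet (K - J) : Set (PBond (F.P K) 0)) ∪ Set.range (iterCentralBond (P := F.P K) (K - J))}, ‖((eV y : (piLogChart (specialUnitaryLogChart (Fin 2)) {b : PBond (F.P K) 0 // b ∉ (combSet (K - J) : Set (PBond (F.P K) 0)) ∪ Set.range (iterCentralBond (P := F.P K) (K - J))}).lie) : {b : PBond (F.P K) 0 // b ∉ (combSet (K - J) : Set (PBond (F.P K) 0)) ∪ Set.range (iterCentralBond (P := F.P K) (K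 - J))} → Matrix (Fin 2) (Fin 2) ℂ) b‖ < 1 / 2}))) := by
      rw [Measure.restrict_restrict hA, inter_eq_left.2 (image_mono hsub)]
    rw [h1, hchart, Measure.restrict_map hΘm hA, restrict_withDensity (hA.preimage hΘm), Measure.restrict_restrict (hA.preimage hΘm),
      hinj.preimage_image_inter hsub]
  refine ⟨e, σ, UZ, UV ∩ {y : EuclideanSpace ℝ (Fin dV) | ∀ b : {b : PBond (F.P K) 0 // b ∉ (combSet (K - J) : Set (PBond (F.P K) 0)) ∪ Set.range (iterCentralBond (P := F.P K) (K - J))}, ‖((eV y : (piLogChart (specialUnitaryLogChart (Fin 2)) {b : PBond (F.P K) 0 // b ∉ (combSet (K - J) : Set (PBond (F.P K) 0)) ∪ Set.range (iterCentralBond (P := F.P K) (K - J))}).lie) : {b : PBond (F.P K) 0 // b ∉ (combSet (K - J) : Set (PBond (F.P K) 0)) ∪ Set.range (iterCentralBond (P := F.P K) (K - J))} → Matrix (Fin 2) (Fin 2) ℂ) b‖ < 1 / 2}, jZ, jV, ρ, hσ0, ⟨h0V, h0S⟩, hjVpos, hjVev, he, he1, he𝓝, hσ, hσs, hUZo, hUV'o,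 h0Z, ?_, hinj.mono hsub,
    fun p hp s hs => hF3 p (hsub hp) s hs, hjZc.continuousOn, hjVc.continuousOn, fun z _ => hjZ0 z, fun y _ => hjV0 y, hchart', hρ, hρUZ, hjZint⟩
  -- (T2-ALL) on the small window
  intro y₁ hy₁
  exact ⟨c₁, hc₁, hT2u y₁ fun b => (hy₁.2 b).le⟩


/-! ## §2 The `EdgeRows` text for locally constant data -/

/-- ★★ **`EdgeRows` BY TEXT FOR LOCALLY CONSTANT DATA.**  If the datum path `x` and the coordinate path `y` are locally constant at every `s ∈ I`, then the
displayed `EdgeRows` text of LINE g18-1 (window chart `c`, transversal `σ`, window `UV`, density `jV`, bond `bnd`, corners `A B`) follows from the endpoint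
equations and the PER-VALUE corner rows: window membership, off-bond agreement, `y s ∈ UV`, `0 < jV (y s)`, the FIBREWISE carrier `∀ᶠ v in 𝓝 (y s), c.jac (x s, σ v) ≠ 0`,
the charted minimiser `c.Φ (x s, σ (y s)) ∈ Sf` with action `m (x s)`.  Continuity and `C^∞`-smoothness hold by local constancy; the JOINT carrier row is the fibrewise
one transported along `x =ᶠ const`.  (Instantiate `θ := θBal F.L γ b₀ p₀ J`, `Sf := histGood …`, `m := minActionRegPr F J K hJK ε₀`.)
[cite: Balaban1985Variational, Thm 1 (8)-(10) p.279] -/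
theorem edgeRows_text_of_locallyConst
    {Sf : Set (GaugeField (F.P K) 0 (Matrix.specialUnitaryGroup (Fin 2) ℂ))} {O : Set (GaugeField (F.P J) 0 (Matrix.specialUnitaryGroup (Fin 2) ℂ))}
    (c : WindowChart F hJK Sf O) (θ : ℝ) (m : GaugeField (F.P J) 0 (Matrix.specialUnitaryGroup (Fin 2) ℂ) → ℝ)
    {dV : ℕ} (σ : EuclideanSpace ℝ (Fin dV) → GaugeField (F.P K) 0 (Matrix.specialUnitaryGroup (Fin 2) ℂ))
    (UV : Set (EuclideanSpace ℝ (Fin dV))) (jV : EuclideanSpace ℝ (Fin dV) → ℝ) (I : Set ℝ)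
    (bnd : PBond (F.P J) 0) (A B : GaugeField (F.P J) 0 (Matrix.specialUnitaryGroup (Fin 2) ℂ))
    (x : ℝ → GaugeField (F.P J) 0 (Matrix.specialUnitaryGroup (Fin 2) ℂ)) (y : ℝ → EuclideanSpace ℝ (Fin dV))
    (hx0 : x 0 = A) (hx1 : x 1 = B)
    (hloc : ∀ s ∈ I, ∀ᶠ s' in 𝓝 s, x s' = x s ∧ y s' = y s)
    (hrow : ∀ s ∈ I, PlaqSmall θ (x s) ∧ (∀ e', e' ≠ bnd → x s e' = A e') ∧ y s ∈ UV ∧ 0 < jV (y s) ∧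
      (∀ᶠ v in 𝓝 (y s), c.jac (x s, σ v) ≠ 0) ∧ c.Φ (x s, σ (y s)) ∈ Sf ∧ wilsonAction4 (c.Φ (x s, σ (y s))) = m (x s)) :
    x 0 = A ∧ x 1 = B ∧
    ∀ s ∈ I,
      PlaqSmall θ (x s) ∧ (∀ e', e' ≠ bnd → x s e' = A e') ∧
      ContinuousAt x s ∧
      ContDiffAt ℝ ⊤ (fun s' : ℝ => fun b : PBond (F.P J) 0 => ((x s' b : Matrix.specialUnitaryGroup (Fin 2) ℂ) : Matrix (Fin 2) (Fin 2) ℂ)) s ∧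
      y s ∈ UV ∧ 0 < jV (y s) ∧
      (∀ᶠ q in 𝓝 ((s : ℝ), y s), c.jac (x q.1, σ q.2) ≠ 0) ∧
      c.Φ (x s, σ (y s)) ∈ Sf ∧
      wilsonAction4 (c.Φ (x s, σ (y s))) = m (x s) ∧
      ContinuousAt y s := by
  refine ⟨hx0, hx1, fun s hs => ?_⟩
  obtain ⟨hW, hoff, hyUV, hjV, hcar, hSf, hmin⟩ := hrow s hs
  have hl := hloc s hs
  have hxl : (fun _ : ℝ => x s) =ᶠ[𝓝 s] x := hl.mono fun s' hs' => hs'.1.symm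
  have hyl : (fun _ : ℝ => y s) =ᶠ[𝓝 s] y := hl.mono fun s' hs' => hs'.2.symm
  refine ⟨hW, hoff, continuousAt_const.congr hxl, ?_, hyUV, hjV, ?_, hSf, hmin, continuousAt_const.congr hyl⟩
  · -- `C^∞` by local constancy of the matrix field of `x`
    refine (contDiffAt_const (c := fun b : PBond (F.P J) 0 => ((x s b : Matrix.specialUnitaryGroup (Fin 2) ℂ) : Matrix (Fin 2) (Fin 2) ℂ))).congr_of_eventuallyEq ?_
    exact hl.mono fun s' hs' => by simp only [hs'.1]
  · -- the joint carrier row from the fibrewise one along `x =ᶠ const`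
    have hx' : ∀ᶠ s' in 𝓝 s, x s' = x s := hl.mono fun s' hs' => hs'.1
    have h2 := hx'.prod_mk hcar
    rw [← nhds_prod_eq] at h2
    exact h2.mono fun q hq => by rw [hq.1]; exact hq.2

/-! ## §3 The base corner's rows -/

/-- ★★ **THE BASE CORNER'S ROWS BY TEXT.**  At a window datum `X` with a minimising live history `U₀` over it (`U₀ ∈ argminHist X` unfolded: `U₀ ∈ fibre X`, `U₀ ∈ Sf`,
`A(U₀) = m X`) and a tube through `U₀` (`σ` continuous, `σ 0 = U₀`, `0 ∈ UV`, `0 < jV 0` — ✓`exists_tubeRows_pos`), the RECOGNITION clause of LINE g18-1's `ChartRows`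
(live fibre points of `Sf` are self-charted and the carrier is a neighbourhood of them) gives the per-value corner rows at `y = 0`: `0 ∈ UV`, `0 < jV 0`, the fibrewise
carrier `∀ᶠ v in 𝓝 0, c.jac (X, σ v) ≠ 0`, `c.Φ (X, σ 0) ∈ Sf`, `A(c.Φ (X, σ 0)) = m X`. [cite: Balaban1985Averaging, §E Prop 6 p.26-27; Balaban1987RG1, (0.13) p.254] -/
theorem cornerRows_base_text
    {Sf : Set (GaugeField (F.P K) 0 (Matrix.specialUnitaryGroup (Fin 2) ℂ))} {O : Set (GaugeField (F.P J) 0 (Matrix.specialUnitaryGroup (Fin 2) ℂ))}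
    (c : WindowChart F hJK Sf O) (m : GaugeField (F.P J) 0 (Matrix.specialUnitaryGroup (Fin 2) ℂ) → ℝ)
    {X : GaugeField (F.P J) 0 (Matrix.specialUnitaryGroup (Fin 2) ℂ)} {U₀ : GaugeField (F.P K) 0 (Matrix.specialUnitaryGroup (Fin 2) ℂ)}
    (hU₀ : U₀ ∈ fibre F ℰp J K hJK X ∧ U₀ ∈ Sf ∧ wilsonAction4 U₀ = m X)
    (hrec : ∀ U, descendTo F ℰp J K hJK U = X → U ∈ Sf → (c.jac (X, U) ≠ 0 ∧ c.Φ (X, U) = U) ∧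
      {z : GaugeField (F.P K) 0 (Matrix.specialUnitaryGroup (Fin 2) ℂ) | c.jac (X, z) ≠ 0} ∈ 𝓝 U)
    {dV : ℕ} {σ : EuclideanSpace ℝ (Fin dV) → GaugeField (F.P K) 0 (Matrix.specialUnitaryGroup (Fin 2) ℂ)} (hσ : Continuous σ) (hσ0 : σ 0 = U₀)
    {UV : Set (EuclideanSpace ℝ (Fin dV))} (h0V : (0 : EuclideanSpace ℝ (Fin dV)) ∈ UV)
    {jV : EuclideanSpace ℝ (Fin dV) → ℝ} (hjV0 : 0 < jV 0) :
    (0 : EuclideanSpace ℝ (Fin dV)) ∈ UV ∧ 0 < jV 0 ∧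
      (∀ᶠ v in 𝓝 (0 : EuclideanSpace ℝ (Fin dV)), c.jac (X, σ v) ≠ 0) ∧
      c.Φ (X, σ 0) ∈ Sf ∧ wilsonAction4 (c.Φ (X, σ 0)) = m X := by
  obtain ⟨hfib, hSf, hmin⟩ := hU₀
  obtain ⟨⟨-, hself⟩, hnhds⟩ := hrec U₀ hfib hSf
  refine ⟨h0V, hjV0, ?_, ?_, ?_⟩
  · have h : Tendsto σ (𝓝 0) (𝓝 U₀) := by rw [← hσ0]; exact hσ.continuousAt
    exact h.eventually_mem hnhds
  · rw [hσ0, hself]; exact hSf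
  · rw [hσ0, hself]; exact hmin

/-! ## §4 Corollary: the constant edge at the base corner -/

/-- ★ **THE `EdgeRows` TEXT AT THE CONSTANT BASE EDGE** (`A = B = X`, `x ≡ X`, `y ≡ 0`, any index set `I`): every displayed clause holds by text from EXW at `X`
(`U₀ ∈ argminHist X` unfolded), the recognition clause of `ChartRows`, window membership of `X`, and the tube of record through `U₀` — i.e. the qualitative rows of
`DetRepB` read at the tube's own corner carry no content beyond EXW + the chart rows; the organ's qualitative content is the OTHER corners (and, with `Icc 0 1 ⊆ I`,
the path between them). [cite: Balaban1985Variational, Thm 1 (8)-(10) p.279; Balaban1985Averaging, §E Prop 6 p.26-27] -/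
theorem edgeRows_text_const
    {Sf : Set (GaugeField (F.P K) 0 (Matrix.specialUnitaryGroup (Fin 2) ℂ))} {O : Set (GaugeField (F.P J) 0 (Matrix.specialUnitaryGroup (Fin 2) ℂ))}
    (c : WindowChart F hJK Sf O) (θ : ℝ) (m : GaugeField (F.P J) 0 (Matrix.specialUnitaryGroup (Fin 2) ℂ) → ℝ)
    {X : GaugeField (F.P J) 0 (Matrix.specialUnitaryGroup (Fin 2) ℂ)} (hX : PlaqSmall θ X) {U₀ : GaugeField (F.P K) 0 (Matrix.specialUnitaryGroup (Fin 2) ℂ)}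
    (hU₀ : U₀ ∈ fibre F ℰp J K hJK X ∧ U₀ ∈ Sf ∧ wilsonAction4 U₀ = m X)
    (hrec : ∀ U, descendTo F ℰp J K hJK U = X → U ∈ Sf → (c.jac (X, U) ≠ 0 ∧ c.Φ (X, U) = U) ∧
      {z : GaugeField (F.P K) 0 (Matrix.specialUnitaryGroup (Fin 2) ℂ) | c.jac (X, z) ≠ 0} ∈ 𝓝 U)
    {dV : ℕ} {σ : EuclideanSpace ℝ (Fin dV) → GaugeField (F.P K) 0 (Matrix.specialUnitaryGroup (Fin 2) ℂ)} (hσ : Continuous σ) (hσ0 : σ 0 = U₀)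
    {UV : Set (EuclideanSpace ℝ (Fin dV))} (h0V : (0 : EuclideanSpace ℝ (Fin dV)) ∈ UV)
    {jV : EuclideanSpace ℝ (Fin dV) → ℝ} (hjV0 : 0 < jV 0) (I : Set ℝ) (bnd : PBond (F.P J) 0) :
    (fun _ : ℝ => X) 0 = X ∧ (fun _ : ℝ => X) 1 = X ∧
    ∀ s ∈ I,
      PlaqSmall θ ((fun _ : ℝ => X) s) ∧ (∀ e', e' ≠ bnd → (fun _ : ℝ => X) s e' = X e') ∧
      ContinuousAt (fun _ : ℝ => X) s ∧
      ContDiffAt ℝ ⊤ (fun s' : ℝ => fun b : PBond (F.P J) 0 => (((fun _ : ℝ => X) s' b : Matrix.specialUnitaryGroup (Fin 2) ℂ) : Matrix (Fin 2) (Fin 2) ℂ)) s ∧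
      (fun _ : ℝ => (0 : EuclideanSpace ℝ (Fin dV))) s ∈ UV ∧ 0 < jV ((fun _ : ℝ => (0 : EuclideanSpace ℝ (Fin dV))) s) ∧
      (∀ᶠ q in 𝓝 ((s : ℝ), (fun _ : ℝ => (0 : EuclideanSpace ℝ (Fin dV))) s), c.jac ((fun _ : ℝ => X) q.1, σ q.2) ≠ 0) ∧
      c.Φ ((fun _ : ℝ => X) s, σ ((fun _ : ℝ => (0 : EuclideanSpace ℝ (Fin dV))) s)) ∈ Sf ∧
      wilsonAction4 (c.Φ ((fun _ : ℝ => X) s, σ ((fun _ : ℝ => (0 : EuclideanSpace ℝ (Fin dV))) s))) = m ((fun _ : ℝ => X) s) ∧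
      ContinuousAt (fun _ : ℝ => (0 : EuclideanSpace ℝ (Fin dV))) s := by
  have hC := cornerRows_base_text F hJK c m hU₀ hrec hσ hσ0 h0V hjV0
  exact edgeRows_text_of_locallyConst F hJK c θ m σ UV jV I bnd X X (fun _ => X) (fun _ => 0) rfl rfl
    (fun s _ => Eventually.of_forall fun _ => ⟨rfl, rfl⟩)
    (fun s _ => ⟨hX, fun _ _ => rfl, hC.1, hC.2.1, hC.2.2.1, hC.2.2.2.1, hC.2.2.2.2⟩)

end Summit.QuantumFields.YangMills.Theorems.FluctuationComparisonRegPrIntLS2BetaCornerOfRecord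

end
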